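import Mathlib
import HarnessLib
import HarnessLib.Audit
import Summits.CriticalPhenomena.Statement
import Literature.Probability.RandomPlanarGeometry.HexParafermion
import Literature.Probability.RandomPlanarGeometry.HexSAW
import Literature.Probability.RandomPlanarGeometry.SLEConvergenceCriterion
import Literature.Probability.RandomPlanarGeometry.ConformalMap
import HarnessLib.Audit.Status.Attr

/-!
Route: SAWDefectDecoherence

# Route SAWDefectDecoherence — the missing half of Cauchy-Riemann for the hexagonal SAW parafermion
is a decoherence estimate - the final-direction law at a vertex star dies at frequency 11/8 faster
than masses spread

It suffices to show X = HexObservableLimitR — Duminil-Copin–Smirnov 2012 Conjecture 2 on the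
HEXAGONAL lattice, averaged against bulk
test functions and normalised at one boundary mid-edge b_δ of a flat zigzag piece, with BOTH marked
points pinned conformally: at the
root a as at b the domain is a horizontal half-plane piece and Λ_δ the exact half-lattice inside a
ρ-ball (rev-15 REPAIR of the shared
target HexObservableLimit, stmt-CriticalPhenomena-5420, refuted-misstated by the corridor witness
SAWDefectDecoherenceHexObservableLimit_refuted: with Λ_δ free in the o(1)-collar at ∂Ω a
boundary-hugging width-1 corridor relocates the
conformally effective root while every old hypothesis holds; the rigid ball at a is the refuter's
first listed repair C′, which the
witness misses) — reached through the mechanism of card parafermion-defect-stability-skeleton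
(spine). At a vertex v let μ_v
be the POSITIVE measure on ℝ recording the lifted final direction θ_a + W(γ) of the x_c-weighted
walks γ from the root a to the three mid-edges
around v (support θ₀ + (π/3)ℤ: six directions, Fourier period 6). Then the plain star sum Σ_t
F_σ(vt) is μ̂_v(5/8) (the signal), DCS Lemma 1
(PROVED in the tree) is EXACTLY μ̂_v(21/8) = 0 at every vertex, and the "other half" of the discrete
Cauchy–Riemann equations — the conjugated
combination T(v) := Σ_t conj(mid{v,t} − c_v) F_σ(vt), whose mesoscopic averages are DCS's curl — is
(ℓ/2)·μ̂_v(−11/8): the missing half is a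
statement about ONE positive angular law at ONE frequency. (Per edge the shift is void: at a fixed
edge W ≡ θ_e − θ_a mod π, so |F_{σ−2}(e)|
= |F_σ(e)| — support SpinShift records this aliasing; the vertex star is the smallest aggregate
where the six directions survive.) Layer 1 =
three cruxes: DefectDecoherence (|T(v)| ≤ C R^{−θ} Σ_t Z(vt), θ > 3/4, for R-deep vertices of any
simply connected domain — an oscillatory
UPPER bound against the positive mass, engine = the card's screening skeleton about v), MassRatio
(POSITIVE two-point masses: δ²Σ_K Z_δ ≤ C
δ^{−3/4} Z_δ(b_δ)) and BoundaryClosureR (the boundary Riemann–Hilbert half: DefectDecoherence →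
MassRatio → X, whose intended proof runs through
the support node ConjugateClassNegligible); supports SpinShift, BoundaryWindingRigidity,
StaggeredSumRule, DecoherenceSynthesis (the two
exponent cruxes ⟹ ConjugateClassNegligible = asymptotic weak ∂̄-closure of F_δ/F_δ(b_δ) given the
vertex relation). Layer 2 = the shared pipeline HexTight, ObservableToSLER, HexTransfer (HexTight
verbatim from SAWResidueField; ObservableToSLER = the shared ObservableToSLE re-targeted at X;
HexTransfer = the shared tail crux stmt-CriticalPhenomena-14221 of SAWDevelopingMap /
SAWPhaseRetrieval / SAWWindingAlias: DCS Conjecture 1 on the hexagonal lattice, written out, IMPLIES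
the δℤ² Statement — lattice universality in exactly the implicational form the deciding theorem
needs). ROUTE CHOICE (rev 17, option a: the layer-2 glue HexToSquare stmt-10473 and the conjecture
node HexConjecture stmt-0808 dropped; rev 20, class default applied under the crux-only
deciding-theorem rule: LatticeUniversality stmt-0807 restated 1:1 in THIS route into HexTransfer,
and the Assembly item is no longer a hypothesis of `closes`): X is the TARGET item (rank 0:
conjecture-grade but DERIVED in-route by the crux BoundaryClosureR and refuter-vetted; counted as a
crux revs 17–20, re-badged target at rev 21 per the gate's target ruling) and the six cruxes = layer
1 (3) + layer 2 (3) are exactly the binders of `closes`; no conjecture-grade content sits in a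
support or assembly item; 13 items.
Lean: `∃ c : ℂ, c ≠ 0 ∧ ∀ (D : Literature.Probability.RandomPlanarGeometry.DobrushinDomain) (ρ : ℝ)
(Λ : ℝ → Finset Literature.Probability.LatticeModels.HexVertex) (m : Fin 2 → ℝ → ℤ) (a b : ℝ → Sym2
Literature.Probability.LatticeModels.HexVertex) (Φ :
Literature.Probability.RandomPlanarGeometry.ConformalEquiv D.carrier
UpperHalfPlane.upperHalfPlaneSet) (L : ℂ → ℂ) (Lb : ℂ) (ψ : ℂ → ℂ), let F : ℝ → Sym2
Literature.Probability.LatticeModels.HexVertex → ℂ := fun δ z =>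
Literature.Probability.RandomPlanarGeometry.SAW.hexParafermionicObservable (Λ δ) (a δ)
Literature.Probability.RandomPlanarGeometry.SAW.hexCriticalFugacity (5 / 8) z; 0 < ρ → (∀ i : Fin 2,
D.carrier ∩ Metric.ball (D.pt i) ρ = {z : ℂ | (D.pt i).im < z.im} ∩ Metric.ball (D.pt i) ρ) → (∀ᶠ δ
: ℝ in nhdsWithin 0 (Set.Ioi 0),
Literature.Probability.RandomPlanarGeometry.SAW.hexDomainSimplyConnected (Λ δ) ∧ a δ ∈
Literature.Probability.RandomPlanarGeometry.SAW.hexDomainBoundary (Λ δ) ∧ b δ ∈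
Literature.Probability.RandomPlanarGeometry.SAW.hexDomainBoundary (Λ δ) ∧ Nonempty
(Literature.Probability.RandomPlanarGeometry.SAW.HexMidEdgeSAW (Λ δ) (a δ) (b δ)) ∧
(Literature.Probability.LatticeModels.hexGraph.induce ((Λ δ : Finset
Literature.Probability.LatticeModels.HexVertex) : Set
Literature.Probability.LatticeModels.HexVertex)).Preconnected ∧ (∀ v ∈ Λ δ, (δ : ℂ) *
Literature.Probability.LatticeModels.hexCenter v ∈ D.carrier) ∧ (∀ i : Fin 2, ∀ v :
Literature.Probability.LatticeModels.HexVertex, (δ : ℂ) *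
Literature.Probability.LatticeModels.hexCenter v ∈ Metric.ball (D.pt i) ρ → (v ∈ Λ δ ↔ m i δ ≤ v.1
1))) → (∀ K : Set ℂ, IsCompact K → K ⊆ D.carrier → ∀ᶠ δ : ℝ in nhdsWithin 0 (Set.Ioi 0), ∀ v :
Literature.Probability.LatticeModels.HexVertex, (δ : ℂ) *
Literature.Probability.LatticeModels.hexCenter v ∈ K → v ∈ Λ δ) → Filter.Tendsto (fun δ : ℝ => (δ :
ℂ) * Literature.Probability.RandomPlanarGeometry.SAW.hexMidpoint (a δ)) (nhdsWithin 0 (Set.Ioi 0))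
(nhds (D.pt 0)) → Filter.Tendsto (fun δ : ℝ => (δ : ℂ) *
Literature.Probability.RandomPlanarGeometry.SAW.hexMidpoint (b δ)) (nhdsWithin 0 (Set.Ioi 0)) (nhds
(D.pt 1)) → Filter.Tendsto (fun x => ‖Φ x‖) (nhdsWithin (D.pt 0) D.carrier) Filter.atTop →
Φ.HasBoundaryValue (D.pt 1) 0 → ContinuousOn L D.carrier → (∀ z ∈ D.carrier, Complex.exp (L z) =
deriv Φ z) → Filter.Tendsto L (nhdsWithin (D.pt 1) D.carrier) (nhds Lb) → Continuous ψ →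
HasCompactSupport ψ → tsupport ψ ⊆ D.carrier → Filter.Tendsto (fun δ : ℝ => (δ : ℂ) ^ 2 * (∑ᶠ e ∈
Literature.Probability.RandomPlanarGeometry.SAW.hexDomainMidEdges (Λ δ), ψ ((δ : ℂ) *
Literature.Probability.RandomPlanarGeometry.SAW.hexMidpoint e) * F δ e) / F δ (b δ)) (nhdsWithin 0
(Set.Ioi 0)) (nhds (c * ∫ z, ψ z * Complex.exp ((5 / 8 : ℂ) * (L z - Lb))))`

## Assembly
Deciding theorem (rev 20; CRUX-ONLY — pure logic over six crux items, axioms propext /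
Classical.choice / Quot.sound): `closes (hDD :
DefectDecoherence) (hMR : MassRatio) (hBC : BoundaryClosureR) (hT : HexTight) (hO :
ObservableToSLER) (hTr : HexTransfer) :
SAWScalingLimit := hTr (hO (hBC hDD hMR) hT)`. The chain in words: BoundaryClosureR turns the two
exponent cruxes DefectDecoherence,
MassRatio into the thesis X = HexObservableLimitR (inside it, the PROVED DecoherenceSynthesis turns
BoundaryWindingRigidity,
DefectDecoherence, MassRatio into the node ConjugateClassNegligible — the reduction
DefectDecoherence → MassRatio →
ConjugateClassNegligible has landed as conjugateClassNegligible_of_exponent_cruxes — and the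
boundary half identifies the limit);
ObservableToSLER turns X + HexTight into DCS Conjecture 1 on the hexagonal lattice (written out);
HexTransfer carries it to δℤ². X is the
target item (rank 0), not a binder of `closes`: it is DERIVED from the layer-1 cruxes by
BoundaryClosureR. The assembly ITEM (rev 20)
is the non-glue frame Assembly := DefectDecoherence → MassRatio → HexTight → HexTransfer →
SAWScalingLimit — the line's two estimates,
tightness and the tail suffice — proved exactly by the two implication cruxes once they land (`fun
hDD hMR hT hTr => hTr (hO (hBC hDD
hMR) hT)` with hBC : BoundaryClosureR, hO : ObservableToSLER; Sketch.lean rc 0), while the ground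
probes intros; aesop / simp_all / tauto
/ trivial / exact? fail on it (SketchProbe.lean); it adds no assumption beyond the cruxes and is NOT
a hypothesis of `closes`. History:
the rev-16 item (DefectDecoherence → MassRatio → BoundaryClosureR → HexTight → ObservableToSLER →
LatticeUniversality → SAWScalingLimit)
carried the hex → δℤ² transport (the content of the dropped support HexToSquare, stmt-10473) and was
consumed by `closes` as the
hypothesis hA — a non-crux hypothesis under the 2026-08-16 crux-only ruling and the conjecture-grade
content the smuggled-conjecture
hold pointed at; the transport is now CRUX content (HexTransfer), and the foreseen glued split of
HexTransfer (LatticeUniversality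
stmt-0807 + HexEndpointApproxExists stmt-9864 + SquareTransfer stmt-14521; glue hexTransfer_of
sorry-free, evidence Reduction.lean on
stmt-14221) stays with the sibling routes SAWResidueField / SAWMassiveIsingTilt. Layer 1 (this
route's mechanism) = DefectDecoherence,
MassRatio, BoundaryClosureR + the supports; layer 2 (shared pipeline) = HexTight, ObservableToSLER,
HexTransfer.

Rationale: WHY THIS LINE. Mechanism (arXiv:1007.0575 Lemma 1, §4 "divergence-free vector field … we expect that
in the limit the curl vanishes"; arXiv:1009.6077 §5
Q3/Q5 "establish preholomorphicity approximately, with estimates"): summing the vertex relation by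
parts gives Σ_e F_δ(e)[∂̄φ + u_e²∂φ](δe) =
O(δ²)·mass and u² = i·ū on the equiangular honeycomb (u³ = i), so weak holomorphy of limits is
exactly "Σ_e ψ(δe) ū_e F_δ(e) → 0", i.e. the
mesoscopic negligibility of the vertex-star defects T(v); grouping the three walks sums at v by
lifted final direction turns VR, the signal
and the defect into the Fourier coefficients of one positive measure μ_v at 21/8, 5/8, −11/8 (the
card's stability indices ι(n) = n(n + 5/4):
the defect channel n = −2 is stable, ι = 3/2; the one unstable alias n = −1, ι = −1/4, is what the
honeycomb identity removes). Predictions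
come with an explicit Coulomb-gas dictionary (e^{−iσ'W} × one-leg operator = vertex operator with
charge shift 2σ' at g = 3/2: Jacobsen2009
§14.4.6 (14.99)–(14.100), DuplantierSaleur1988, doi:10.1103/physreve.50.1123;
`Literature.Barriers.CriticalPhenomena.legExponent`): one-end
winding variance (8/3) log R, signal/mass ≍ R^{−25/48} (forced independently by h_b = 5/8, x₁ = 5/48
and Conjecture 2), defect/mass ≍
R^{−1−25/48} from the sublattice-gradient term (3ℓ/2)δ∂f of the smooth limit and R^{−2−25/48} for
genuine class structure, bulk/boundary mass
ratio ≍ δ^{−25/48}: an exponent window (25/48, 73/48) which the route cuts at 3/4 (below 1 because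
every Taylor step of the glue costs
δ^{1−cut}). So the interior half becomes ONE oscillatory upper bound on a positive angular law,
provable by DECOHERENCE along the card's
screening skeleton (single-crossing circles about v: an exact weight-multiplicative,
winding-additive renewal; the lifted entry-angle law is
pushed through positive increment kernels and Poisson summation over the entry point's
2π-periodicity produces the aliased harmonics), plus ONE
comparison of positive partition functions — no oscillatory lower bound, no Hodge split, no
ℤ/3-mixing crux. Imported areas:
characteristic-function / decoherence estimates for additive functionals over a renewal structure
(probability), the discrete Hopf
Umlaufsatz already in the tree (HexSAWWinding, HexSAWHopfPath) for winding rigidity and the annulus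
lift, Coulomb-gas numerology as prediction
only, the Kemppainen–Smirnov / LSW pipeline downstream (arXiv:1212.6215,
LawlerSchrammWerner2004SAW). Prior routes: SAWResidueField asks for the face-residue Dirichlet
ENERGY to vanish (stmt-5421) with no engine beyond two-walk interference sums; SAWParafermion /
SAWHexUniversality quarantine Conjecture 2 whole; here the interior half = a decoherence bound on
one positive angular law + a positive mass comparison, both falsifiable by one Monte-Carlo run.

RANKED CRUXES. #0 HexObservableLimitR (target, rank 0; conjecture-grade and refuter-vetted; counted
as a crux revs 17–20, re-badged target at rev 21 because it is derived in-route by the crux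
BoundaryClosureR and is not a binder of the crux-only `closes`) — DCS 2012 Conjecture 2 (hexagonal
lattice), averaged against bulk test functions ψ ∈ C_c(Ω) and normalised at one boundary mid-edge
b_δ of a flat good-zigzag piece, ROOT PINNED CONFORMALLY: ∃ c ≠ 0 universal with δ²⟨ψ, F_δ⟩/F_δ(b_δ)
→ c ∫ ψ exp((5/8)(L − L_b)) for every Dobrushin domain that is a horizontal half-plane piece near a
AND near b, every admissible discretisation family that is the exact half-lattice (rows ≥ m_i(δ)) in
a ρ-ball about each marked point, a_δ → a, b_δ → b boundary mid-edges, φ: a ↦ ∞, b ↦ 0, L = log φ'.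
Rev-15 repair of the shared HexObservableLimit (stmt-CriticalPhenomena-5420, refuted-misstated
2026-08-15 by SAWDefectDecoherenceHexObservableLimit_refuted: the corridor witness relocates the
conformal root 3/4 → 1/2 inside the free o(1)-collar; C′ = the refuter's first listed repair: no
channel can be forced on walks leaving a rigid half-lattice ball). (why it might fail: needs BOTH
the interior half (decoherence + masses) and conformally covariant boundary data (BoundaryClosureR);
F(b_δ)-normalisation universal only for the zigzag class (built in); the collar away from a, b stays
free, but a relocation witness needs a forced channel at the root, which the rigid ball excludes;
Conj. 2 open since 2010.) [DuminilCopinSmirnov2012, arXiv:1007.0575, Smirnov2007ICM,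
KennedyLawler2013, arXiv:0810.2188,
Summit.CriticalPhenomena.SAWScalingLimit.Theorems.SAWDefectDecoherenceHexObservableLimit_refuted]
#2 DefectDecoherence (crux) — card K1+K2 as a VERTEX-STAR aggregate — universal C and θ > 3/4 such
that for every simply connected hexagonal domain Λ, boundary root a = {u, w} (u ∉ Λ ∋ w), vertex v
that is R-deep (every vertex y with |c_y − c_v| ≤ R lies in Λ, R ≥ 1): |Σ_{t ∼ v} conj(mid{v,t} −
c_v) · F_{x_c,5/8}({v,t})| ≤ C R^{−θ} Σ_{t ∼ v} F_{x_c,0}({v,t}). (= |μ̂_v(−11/8)| ≤ C' R^{−θ}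
μ̂_v(0) for the lifted final-direction law μ_v; VR is μ̂_v(21/8) = 0, the signal μ̂_v(5/8) ≍
R^{−25/48} μ̂_v(0).) Predicted θ = 1 + 25/48 (gradient term), class structure proper at 2 + 25/48;
the per-edge form is void (|F_{σ−2}(e)| = |F_σ(e)|, SpinShift). Engine (two-layer plan): the
screening skeleton about v. [difficulty: open-problem] (why it might fail: θ > 3/4 against the mass
is quantitative: the vertex class imbalance must decay at least like R^{−0.23} relative to the
signal R^{−25/48}; persistent lattice-scale class structure (curl not vanishing even weakly), too
few screens, or an uncancelled unstable alias n = −1 break it.) [arXiv:1007.0575, arXiv:1009.6077,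
DuplantierSaleur1988, Jacobsen2009, doi:10.1103/physreve.50.1123,
Literature.Barriers.CriticalPhenomena.SAWNoUnitaryCFT,
Summits/CriticalPhenomena/SAWScalingLimit/Ideas/parafermion-defect-stability-skeleton.md]
#3 MassRatio (crux) — positive-measure comparison of critical two-point masses in the old target's
setting (flat near b only; a fortiori in HexObservableLimitR's): for every compact K ⊂ Ω there is C
with δ² Σ_{e : δ·mid e ∈ K} Z_δ(e) ≤ C δ^{−3/4} Z_δ(b_δ) eventually as δ → 0+, where Z_δ = F_{x_c,
0} = Σ_{γ : a_δ → ·} x_c^{ℓ} (predicted ratio δ^{−25/48} from h_b = 5/8, x₁ = 5/48; exponent cut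
3/4). [difficulty: open-problem] (why it might fail: needs the boundary two-point function from
below and the bulk one from above within δ^{0.23} of the predicted δ^{5/4}, δ^{35/48}; rigorous 2D
SAW bounds are far weaker (bridge identities give ≈ δ² per boundary point, unfolding loses e^{c√n});
fjords near a could starve b_δ.) [DuminilCopinSmirnov2012, LawlerSchrammWerner2004SAW,
MadrasSlade1993, DuminilCopinHammond2013, KennedyLawler2013, arXiv:2310.17299]
#4 BoundaryClosureR (crux) — the boundary half, conditional form: DefectDecoherence → MassRatio →
HexObservableLimitR (over the two exponent cruxes, for file order; rev-15 re-targeting of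
BoundaryClosure, stmt-CriticalPhenomena-8536, whose conclusion was the refuted target; intended
shape, checked in Sketch.lean: DecoherenceSynthesis gives ConjugateClassNegligible for C¹ ψ, then
the boundary half proper: local L¹ bounds and the boundary Riemann–Hilbert data — arg F_δ fixed on
∂Ω by winding rigidity, modulus = boundary two-point function, flat zigzag pieces at a and b —
identify the limit with one universal c ≠ 0; the rigid patch at a only helps: reflection across the
flat piece controls φ_δ up to the root). The analogue of SAWResidueField's HarmonicPartLimit
(stmt-5422) without the Hodge split. [deps: DefectDecoherence, MassRatio, ConjugateClassNegligible,
DecoherenceSynthesis] [difficulty: open-problem] (why it might fail: weak interior closure gives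
neither compactness nor a maximum principle; local L¹ bounds on F_δ/F_δ(b_δ) are an exponent-sharp
Harnack statement for SAW two-point functions; the boundary modulus carries Kennedy–Lawler lattice
factors; c may oscillate with the discrete class at b.) [arXiv:1007.0575, arXiv:1009.6077,
KennedyLawler2013, arXiv:0810.2188, ChelkakSmirnov2012Ising, DuminilCopinSmirnov2012]
#5 HexTight (crux) — eventual tightness (IsTightAlongMesh, NOT the refuted all-δ form of stmt-0772)
of the critical hexagonal SAW laws on CurveClass ℂ for every Dobrushin domain and hexagonal endpoint
approximation; shared (stmt-CriticalPhenomena-5423). [difficulty: open-problem] (why it might fail: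
no RSW/annulus-crossing technology for SAW (n = 0: no FKG; KS17 §4 covers FK, percolation, harmonic
explorer, LERW); strongest inputs: sub-ballisticity (DCH13, arXiv:2310.17299); eventual form avoids
refuted all-δ item 0772.) [KemppainenSmirnov2017, DuminilCopinHammond2013, arXiv:2310.17299,
arXiv:1212.6215, Summit.CriticalPhenomena.SAWScalingLimit.Theorems.SAWParafermionTight_refuted]
#6 ObservableToSLER (crux) — the martingale-observable identification: HexObservableLimitR →
HexTight → HexSAWScalingLimit written out (DCS Conjecture 1): the b-normalised observable in the
slit domains is an exact discrete martingale, its limit forces the driving process to be √(8/3)B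
(LSW03 Prop. 5.2), tightness + uniqueness conclude (SLEConvergenceCriterion). Rev-15 re-targeting of
the shared ObservableToSLE (stmt-CriticalPhenomena-10472, vacuous once its antecedent was refuted);
first step now explicit: bootstrap Conj. 2 from the flat-pinned family to Carathéodory-converging
slit domains with rough marked points. [deps: HexObservableLimitR, HexTight] [difficulty: XL] (why
it might fail: the martingale needs the observable limit in the SAW's own slit domains (rough tip,
Carathéodory-uniform) while HexObservableLimitR is per fixed Jordan domain, flat and lattice-exact
at a and b; projective data fix κ = 8/3 but not the drift, so the b-normalisation is load-bearing.)
[LawlerSchrammWerner2003, KemppainenSmirnov2017, DuminilCopinSmirnov2012Clay, Smirnov2007ICM,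
DuminilCopinSmirnov2012, arXiv:math/0209343]
#7 HexTransfer (crux) — the lattice-universality transfer in implicational form (shared
stmt-CriticalPhenomena-14221 with SAWDevelopingMap / SAWPhaseRetrieval / SAWWindingAlias; rev-20 1:1
restatement in THIS route of LatticeUniversality, stmt-0807, which stays with its sibling routes):
DCS 2012 Conjecture 1 — written out verbatim as the conclusion of ObservableToSLER (for every
Dobrushin domain and hexagonal endpoint approximation the critical hexagonal SAW law, pushed to
CurveClass ℂ, converges in law to chordal SLE(8/3)) — IMPLIES the δℤ² sub-problem Statement. Weaker
than the asymptotic equality of laws; Iff.rfl-equivalent to HexConjecture → SAWScalingLimit; implied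
by LatticeUniversality + the routine transport (HexEndpointApproxExists stmt-9864, SquareTransfer
stmt-14521: its foreseen glued split, glue hexTransfer_of sorry-free in the evidence Reduction.lean
on stmt-14221); survived two crux-attacks (03:34Z, 03:51Z) and is grounded new/open (06:18Z).
[difficulty: open-problem] (why it might fail: open content = lattice universality ℤ² vs Hex of the
critical SAW law: uniform ℤ² SAW lies in no Yang–Baxter family (GM19 p.1; barrier
NienhuisWeightsExcludeVertexSAW), so no transfer tool exists even given the Hex SLE(8/3) limit;
Kennedy–Lawler boundary effects could split ℤ² endpoint classes.) [GlazmanManolescu2019,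
KennedyLawler2013, DuminilCopinSmirnov2012, LawlerSchrammWerner2004SAW,
Literature.Barriers.CriticalPhenomena.NienhuisWeightsExcludeVertexSAW,
Literature.Barriers.CriticalPhenomena.not_hasExactVertexRelationZ2]
(Route choice. Rev 17, option a: the conjecture node HexConjecture — shared
stmt-CriticalPhenomena-0808, DCS Conjecture 1 verbatim, the conclusion of ObservableToSLER — and the
layer-2 glue HexToSquare — shared stmt-CriticalPhenomena-10473, HexConjecture → LatticeUniversality
→ SAWScalingLimit — dropped, both staying with sibling routes. Rev 20, class default under the
crux-only deciding-theorem rule: LatticeUniversality → HexTransfer so that `closes` binds cruxes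
only and the hex → δℤ² transport is crux content rather than assembly content; promoting the
transport instead of swapping would have made 8 > 7 cruxes.)
#9 ConjugateClassNegligible (support) — the NODE the engine delivers (SAWResidueField's foreseen
CurlIsMesoscopicallySmall, L¹ form): in the old target's setting, for every ψ ∈ C¹_c(Ω), δ² Σ_{black
b ∼ white w} ψ(δ·mid) conj(c_w − c_b) F_δ({b,w}) / F_δ(b_δ) → 0 (with the vertex relation:
asymptotic weak ∂̄-closure of F_δ/F_δ(b_δ)); a DERIVED node: DefectDecoherence → MassRatio →
ConjugateClassNegligible is PROVED in the tree (conjugateClassNegligible_of_exponent_cruxes, via the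
proved DecoherenceSynthesis + BoundaryWindingRigidity); it is not a hypothesis of anything
downstream (BoundaryClosureR is stated over the two cruxes) and records the node other engines may
reach; standalone it is the interior half of Conj. 2. [difficulty: derived from cruxes #2–#3
(reduction proved); standalone unproved] [arXiv:1007.0575, arXiv:1009.6077]
#9 SpinShift (support) — exact spin-shift identity (c_t − c_v)² F_{x,σ}({v,t}) = (c_w − c_u)²
F_{x,σ−2}({v,t}) for a boundary root a = {u,w}: the ALIASING WITNESS (|F_{σ−2}(e)| = |F_σ(e)| per
edge). [difficulty: provable-now] [DuminilCopinSmirnov2012, arXiv:1203.2959]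
#9 BoundaryWindingRigidity (support) — all SAWs between two boundary mid-edges of a simply connected
hexagonal domain have the same winding (discrete Umlaufsatz); hence |F_{x,σ}(b)| = Z(b).
[difficulty: L] [DuminilCopinSmirnov2012, arXiv:1009.6077]
#9 StaggeredSumRule (support) — the exact counter-term from DCS Lemma 1
(`DuminilCopinSmirnov2012_lemma1_holds`): for every B ⊆ Λ, 2·Σ_{black v ∈ B} Σ_{w ∈ B, w ∼ v} (mid −
c_v)F + Σ_{v ∈ B} ε(v) Σ_{w ∼ v, w ∉ B} (mid − c_v)F = 0; corollary: the u-twisted component is a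
pure boundary term. [difficulty: provable-now] [DuminilCopinSmirnov2012, arXiv:1007.0575,
Literature.Barriers.CriticalPhenomena.ParafermionicHalfCauchyRiemann]
#9 DecoherenceSynthesis (support) — glue of layer 1: BoundaryWindingRigidity → DefectDecoherence →
MassRatio → ConjugateClassNegligible (group the black→white edge sum by black vertex; vertex-star
defects bounded by DefectDecoherence at depth d/δ, the Taylor term by (δ/√3)‖∇ψ‖_∞ Σ_K Z, masses by
MassRatio, Z_δ(b_δ) = |F_δ(b_δ)| by rigidity; total ≤ C'(δ^{θ−3/4} + δ^{1/4}) → 0). [difficulty: M]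
[DuminilCopinSmirnov2012]

TWO-LAYER PLAN. Foreseen glued splits (k ≤ 3, depth 1), none filed now. DefectDecoherence ⇐
SkeletonFactorisation (exact once the definition lands: cutting a walk a → star(v) at a circle about
v crossed exactly once is a weight-multiplicative, winding-additive bijection onto outer × inner
walks; between consecutive screens the winding is the unwrapped polar increment plus a bounded
tangent term — an annulus Umlaufsatz on HexSAWWinding; so μ̂_v(ξ) = Σ_skeletons Outer ⊗ Π(positive
increment kernels) ⊗ Inner) → ScreenAbundance (positive measure: under the x_c-law of walks a →
star(v) the number of screens among radii 1 … R
is ≥ η log R except with probability ≤ R^{−θ₁}, θ₁ > 3/4; CG star exponents predict 3/2 per scale) →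
TwistedEntryDecoherence (positive measure + one exact
cancellation: given the skeleton, the aliased harmonics of the lifted entry-angle law in the defect
channel (5/8 + n, n ∈ {−2, +1, +4, …}) are
≤ R^{−θ}·mass, the unstable alias n = −1 entering the conjugated star sum only through a coefficient
the vertex relation makes O(R^{−1})) →
DefectDecoherence. MassRatio ⇐ BoundaryMassLowerBound (Z_δ(b_δ) ≥ c δ^{3/4+λ_b}) →
BulkMassUpperBound (δ²Σ_K Z_δ ≤ C δ^{λ_b}) → MassRatio. BoundaryClosureR ⇐ LocalL1Bound (δ²Σ_K |F_δ|
≤ C_K |F_δ(b_δ)|, a Harnack statement; also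
upgrades ConjugateClassNegligible from C¹ to continuous ψ) → RiemannHilbertIdentification (weak
limits with ∂̄ = 0, DCS boundary argument and
flat-zigzag normalisation are c·e^{(5/8)(L − L_b)}) → BoundaryClosureR; ObservableToSLER as the
shared ObservableToSLE in SAWResidueField, preceded by the flat-pinned → Carathéodory bootstrap.
HexTransfer ⇐ LatticeUniversality (stmt-0807) → HexEndpointApproxExists (stmt-9864) → SquareTransfer
(stmt-14521) → HexTransfer, glue hexTransfer_of already sorry-free (evidence on stmt-14221) — the
children are shared sibling items, not filed here.

KILL CRITERIA. A measured or proved defect exponent θ ≤ 25/48 for |T(v)|/Σ_t Z(vt) at deep vertices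
— i.e. vertex class imbalance NOT decaying relative to the
signal — kills the line outright and refutes the weak (curl → 0) reading of DCS Conjecture 2: close
`refuted:DefectDecoherence` with the data as
census and hand it to SAWResidueField as negative knowledge on [R]. θ ∈ (25/48, 3/4] measured: ONE
repair, `--restate` the pair
(DefectDecoherence at θ > θ₀, MassRatio at exponent θ₀) for a θ₀ below the measured θ (the glue
tolerates any cut < 1); likewise ¬MassRatio at
3/4 with the decoherence side standing ⇒ re-cut upward once (≤ 1); a second failure of either closes
the route. ¬BoundaryClosureR ⇒ pivot shared
with SAWResidueField's [H]: restate with the boundary ARGUMENT condition only or flux normalisation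
on an arc instead of the edge b_δ.
¬HexObservableLimitR (δ-oscillating constant, or a second misstatement witness inside the remaining
collar freedom) ⇒ ONE more restatement (c depending on the discrete class at b, resp. the canonical
discretisation v ∈ Λ_δ ↔ δc_v ∈ Ω), else close; history: ¬HexObservableLimit (stmt-5420, corridor
witness, refuted-misstated 2026-08-15) ⇒ repaired as HexObservableLimitR (rev 15). ¬HexTight /
¬HexTransfer (the latter = DCS Conjecture 1 on the hexagonal lattice true while the δℤ² Statement
fails, i.e. a failure of lattice universality) are conjunct-level events shared with the sibling
routes. ResidueEnergyVanishes ∧ HarmonicPartLimit proved in SAWResidueField moot items 2–4 (route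
superseded); DCS Conjecture 1 on the hexagonal lattice (the shared item HexConjecture, stmt-0808, on
the sibling routes) or SAWScalingLimit proved directly moot everything.

NOT DECOMPOSED YET. The flat-pinned → Carathéodory bootstrap of Conj. 2 (inside ObservableToSLER).
The skeleton engine (screens, crossing edges, unwrapped increments, the transfer structure over
crossing edges, the grid of radii, the
persistence exponent of unscreened stretches, per-annulus anti-concentration at frequency 11/8, the
bookkeeping of the unstable alias) —
children of DefectDecoherence once the definition request lands; the two positive mass exponents
inside MassRatio; everything on the boundary
side (local L¹ bounds, the Riemann–Hilbert problem, Kennedy–Lawler factors, Carathéodory uniformity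
over slit domains, rough b, continuous vs C¹
test functions) inside BoundaryClosure / ObservableToSLE; the exponent cut (3/4) — a planner's
choice inside the predicted window (25/48,
73/48), re-cut by restating the pair if one side lands with another exponent; larger ℤ/3-symmetric
bumps than the vertex star (smooth radial
weights about v decay like R^{−2−25/48} but are not needed); the card's relative form, Z3Mixing and
oscillatory NonDegeneracy (K3, K4 — replaced
by the mass normalisation); all constants. ROUTE SHAPE (revs 20–21): the target X + six cruxes =
layer 1 (DefectDecoherence, MassRatio, BoundaryClosureR) + the shared layer 2 (HexTight,
ObservableToSLER, HexTransfer); `closes` binds exactly the six cruxes and X is derived — honestly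
two theses glued at X, kept in ONE route because the layer-2 cruxes are shared items staffed once
however many routes want them (SAWPhaseRetrieval's deciding theorem is literally hTr (hO hX hT)):
filing the pipeline as its own route, as recorded at rev 17, would now duplicate inventory and leave
this route with a fat bridge crux X → Statement, so that plan is superseded. The decomposition of
HexTransfer into LatticeUniversality (stmt-0807) + HexEndpointApproxExists (stmt-9864) +
SquareTransfer (stmt-14521) is recorded on stmt-14221 (glue hexTransfer_of, sorry-free) and carried
by the sibling routes.

CHEAPEST FALSIFIER. One Monte-Carlo run measures both exponents of the cut: x_c-weighted SAWs on
hexagonal discs of radius R = 8 … 128 from a boundary mid-edge a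
to the star of the central vertex v (pivot + Berretti–Sokal, or transfer-matrix enumeration up to R
≈ 10): (a) θ̂ := −d log(|T(v)|/Σ_t
Z(vt))/d log R must exceed 3/4 (predicted 1 + 25/48 ≈ 1.52, the leading part being the alternating
sublattice gradient ±(3ℓ/2)δ∂f = the card's
∓(5/16)φ''/φ'·δ; after subtracting it the residual should fall like R^{−2−25/48}); the card's
enumeration at R ≤ 5 saw the class-defect offset
fall only 0.22 → 0.17, pre-asymptotic; (b) the same walks give the signal exponent from |Σ_t
F_σ(vt)|/Σ_t Z (predicted 25/48) and the bulk/
boundary mass ratio (predicted δ^{−25/48}, must stay below δ^{−3/4}). θ̂ ≤ 25/48 kills the line; θ̂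
∈ (25/48, 3/4] or a mass-ratio exponent ≥
3/4 forces the one allowed re-cut. Provable-now sanity anchors: SpinShift, StaggeredSumRule (the
card verified the vertex relation / staggered
sum rule to 1e−13 / 1e−15 on enumerated discs). Filed (route review #3): kit jobs j003801 + j003797
on stmt-8549.

NUMBERS. σ = 5/8, x_c = 1/√(2+√2) (DCS Thm 1 / Lemma 1, both proved in the tree); embedded
honeycomb: edge length ℓ = 1/√3, black→white unit vectors u_k =
e^{iπ/6}ω^k, u_k³ = i, hence ū = −i u² and u = i ū²; lifted final directions live on θ₀ + (π/3)ℤ ⇒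
μ̂_v has period 6: VR ⟺ μ̂_v(21/8) = 0, signal
μ̂_v(5/8), defect μ̂_v(−11/8); per EDGE the period collapses to 2 (|F_{σ−2}| = |F_σ|: the aliasing
pitfall); stability index ι(n) = n(n + 5/4):
ι(−2) = 3/2, ι(−1) = −1/4 (unique unstable alias, removed by VR), ι(+1) = 9/4, ι(+2) = 13/2; Coulomb
gas (g = 3/2): x(σ') − x(0) = (4/3)σ'², one-end winding variance (8/3) log R (Jacobsen2009
(14.100)); predicted exponents against the mass: signal 25/48,
vertex defect 1 + 25/48 = 73/48 (gradient) / 2 + 25/48 = 121/48 (class structure); unscreened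
persistence (x₃ − x₁) = 3/2 per scale; masses: Z(a→b_δ) ≍
δ^{5/4}, δ²Σ_K Z ≍ δ^{35/48}, ratio δ^{−25/48} vs the cut δ^{−3/4}; glue slack δ^{1/4}. Items: 13 (X
— target, rank 0 — + 6 cruxes, HexTransfer replacing LatticeUniversality since rev 20; 5 supports, 4
of them proved; 1 assembly frame; rev 16: 15).

DEFINITION REQUESTS. One, filed against DefectDecoherence: `HexSAWScreenSkeleton`
(Literature/Probability/RandomPlanarGeometry): for γ : HexMidEdgeSAW Λ a z and a radius r about a
vertex centre, the screen predicate and crossing edge, the outer/inner product bijection (weights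
multiply, windings add), the lifted final direction and the unwrapped polar increment between
screens — needed only for the children of DefectDecoherence. Foreseen, not filed: Carathéodory
convergence of marked hexagonal domains (HexObservableLimitR for general prime ends). No cite facts:
DCS Lemma 1 is proved; every statement is over HexParafermion / HexSAW / ConformalMap /
SLEConvergenceCriterion (Sketch.lean rc 0).

Novelty: Searches (2026-08-15, this seat; OpenAlex 429, searchd intermittently down): `lit search --hybrid
"parafermionic observable self-avoiding walk spin winding other half Cauchy-Riemann"` (12; hit 6 =
Duminil-Copin Ensaios doi:10.21711/217504322013/em251 pp. 288-302, the half-CR discussion; rest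
textbooks); `lit search --source crossref "winding angle distribution two-dimensional self-avoiding
walks conformal invariance"` (9: DuplantierSaleur1988, doi:10.1103/physreve.50.1123, Chang 2000,
Cardy-Redner 1984); `lit search --source crossref "harmonic measure and winding of conformally
invariant curves"` (Duplantier-Binder doi:10.1103/physrevlett.89.264101,
doi:10.1016/j.nuclphysb.2008.05.020 - the mixed winding spectrum, quadratic in the rotation
variable); `lit search --source zbmath "parafermionic observable self-avoiding walk"` (3:
DuminilCopinSmirnov2012, DuminilCopin2013Parafermion, arXiv:1402.5376); `lit search --source arxiv
"parafermionic observable spin dependence ... discrete holomorphicity fails"` (0); `lit galaxy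
search "parafermionic observable" --star all` (7: Ensaios, DC-Manolescu fractal FK, arXiv:2409.03235
- Zhou's claimed half-CR completion for bond percolation via rotational invariance, a different
mechanism); `lit galaxy search "winding angle distribution" --star pdf` (5: Fisher-Privman-Redner
1984 J.Phys.A 17 L569; Jacobsen2009 read §14.4.6 eqs (14.96)-(14.100): one-end SAW winding Gaussian
with variance (4/g) log R = (8/3) log R at g = 3/2, i.e. |E e^{i xi W}|  [refs: 10.21711/217504322013/em251, 10.1103/physreve.50.1123, 10.1103/physrevlett.89.264101, 10.1016/j.nuclphysb.2008.05.020, 1402.5376, 2409.03235, 2310.17299, 1009.6077, 1203.2959, 1007.0575, doi:10.21711/217504322013/em251, doi:10.1103/physreve.50.1123, doi:10.1103/physrevlett.89.264101, doi:10.1016/j.nuclphysb.2008.05.020, DuplantierSaleur1988, DuminilCopinSmirnov2012, Jacobsen2009]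

Barriers (technique_class: parafermion-decoherence, screening-skeleton): - technique_class: parafermion-decoherence, screening-skeleton
- Literature.Barriers.CriticalPhenomena.ParafermionicHalfCauchyRiemann: applies head-on and is the
starting point (its kernel = what VR + boundary values cannot see). Evaded in statement: F_δ is
never reconstructed from the vertex relations; VR is used once, as the exact counter-term
(μ̂_v(21/8) = 0, StaggeredSumRule) for the unique unstable alias, and the remaining defect
μ̂_v(−11/8) is bounded by a decoherence ESTIMATE on the walk law (DefectDecoherence) plus positive
mass bounds — outside "linear relations + boundary data", and false for the δ-independent kernel
elements HexKernel.witness, which are not walk sums. Honest: if DefectDecoherence fails at every cut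
the barrier wins for this observable.
- Literature.Barriers.CriticalPhenomena.FKParafermionicHalfCauchyRiemann: same structure for the FK
parafermion (q ≠ 2); our items are of its non-blocked type (an estimate on the model, not a
determination from the relations); the vertex-star angular-law reading transfers to FK spins σ = 1 −
(2/π)arccos(√q/2) as a by-product, not an evasion claim.
- Literature.Barriers.CriticalPhenomena.NienhuisWeightsExcludeVertexSAW (with
not_hasExactVertexRelationZ2): respected — the mechanism is hexagonal (VR supplies the counter-term
for the unstable alias; on ℤ² nothing removes it); δℤ² is reached only through LatticeUniversality
(stmt-0807).
- Literature.Barriers.CriticalPhenomena.EmbeddingModulusUniqueness / SmirnovTriangular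

Novelty grade: new-combination — ROUTE REVIEW rreview-0815T12-7 (refuter, 08-16 ~07:50Z; rev 22; reviews #1–3 ≤08-15 19:10Z predate the corridor refutation of 5420 and revs 15–21; sibling rreview-0815T12-6 and the 14005 crux campaign STAND). VERDICT KEEP OPEN; no crux blocked; not a recombination (closed: SAWHexUniversality, SAWAlg (refuter refuter-rreview-0815T12-7-0, 2026-08-16T07:18:20Z; prior: arXiv:1007.0575 (Duminil-Copin–Smirnov 2012: Lemma 1, §4 curl remark, Conj. 2), arXiv:1009.6077 (Smirnov ICM 2010, Q3/Q5), DuplantierSaleur1988 / doi:10.1103/physreve.50.1123 (winding-angle law), arXiv:1203.2959 (Elvey Price–de Gier–Guttmann–Lee 2012), Literature.Barriers.CriticalPhenomena.ParafermionicHalfCauchyRiemann (tree), arXiv:math/0209343 (LSW: SAW scaling limit ⇒ SLE(8/3)), KemppainenSmir)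

History (route lifecycle, newest last):
- 2026-08-15T16:21:47Z · rev 14: restated ObservableToSLE (stmt-CriticalPhenomena-5424), HexToSquare (stmt-CriticalPhenomena-5428) — route-repair (cone → staffable; re-route around the unlisted registry conjecture, as SAWResidueField rev 3 / SAWDevelopingMap rev 2): (1) ADD crux HexConjecture (planner-rbadge-CriticalPhenomena-SAWDefectDeco-0029e697-g4-0)
- 2026-08-15T16:21:47Z · rev 14: dropped HexScalingLimit — route-repair (cone → staffable; re-route around the unlisted registry conjecture, as SAWResidueField rev 3 / SAWDevelopingMap rev 2): (1) ADD crux HexConjecture (planner-rbadge-CriticalPhenomena-SAWDefectDeco-0029e697-g4-0)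
- 2026-08-15T23:46:18Z · BROKEN — HexObservableLimit (stmt-CriticalPhenomena-5420, target) refuted by Summit.CriticalPhenomena.SAWScalingLimit.Theorems.SAWDefectDecoherenceHexObservableLimit_refuted @ b90fe791a4c9 (refuter-cdisprove-stmt-CriticalPhenomena-8536-0)
- 2026-08-16T00:00:02Z · rev 15: restated HexObservableLimit (stmt-CriticalPhenomena-5420 refuted), BoundaryClosure (stmt-CriticalPhenomena-8536), ObservableToSLE (stmt-CriticalPhenomena-10472), Assembly (stmt-CriticalPhenomena-8539) — repair: HexObservableLimit (stmt-CriticalPhenomena-5420, target) refuted-misstated by Summit.CriticalPhenomen (planner-rfix-CriticalPhenomena-SAWDefectDeco-0029e697-0)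
- 2026-08-16T00:00:02Z · REPAIRED (restate HexObservableLimit, BoundaryClosure, ObservableToSLE, Assembly) — back to open: repair: HexObservableLimit (stmt-CriticalPhenomena-5420, target) refuted-misstated by Summit.CriticalPhenomena.SAWScalingLimit.Theorems.SAWDefectDecoherenceHexO (planner-rfix-CriticalPhenomena-SAWDefectDeco-0029e697-0)
- 2026-08-16T00:08:31Z · rev 16: restated Assembly (stmt-CriticalPhenomena-14006) — route-repair (ground-failed): restate the assembly item (stmt-CriticalPhenomena-14006, the route's ONLY ground flag: ground.trivial — its rev-15 signature took (planner-rground-CriticalPhenomena-SAWDefectDeco-0029e697-0)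
- 2026-08-16T03:09:13Z · rev 17: dropped HexToSquare, HexConjecture — route-choice (hold smuggled-conjecture; option a = DROP ITEMS): drop HexToSquare (stmt-10473, support — not a hypothesis of closes; the Assembly item stmt-14046 (planner-rchoice-CriticalPhenomena-SAWDefectDec-df702c8a-0)
- 2026-08-16T06:36:13Z · rev 20: restated LatticeUniversality (stmt-CriticalPhenomena-0807), Assembly (stmt-CriticalPhenomena-14046) — route-choice (unit rchoice-…-f28a3bf5, choice deadline passed; class smuggled-conjecture, hold 2026-08-16T02:41:14Z 'HexToSquare, HexObservableLimitR: 2 conject (planner-rchoice-CriticalPhenomena-SAWDefectDec-f28a3bf5-0)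

sub-problem: SAWScalingLimit · status: open · opened planner-plancard-CriticalPhenomena-SAWScaling-a25779c2-0 2026-08-15T12:56:06Z · rev 22 · ledger route-CriticalPhenomena-SAWDefectDecoherence
GENERATED by the gate from the ledger (D-0016/17). Provers cite these decls: `theorem foo : Summit.CriticalPhenomena.SAWScalingLimit.Theses.SAWDefectDecoherence.<Decl> := …` in Summits/CriticalPhenomena/SAWScalingLimit/Theorems/<Name>.lean.
-/

namespace Summit.CriticalPhenomena.SAWScalingLimit.Theses.SAWDefectDecoherence

open scoped BigOperators Topology Manifold Classical MeasureTheory ProbabilityTheory Matrix InnerProductSpace ComplexConjugate ContinuousMap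
open Filter Set Function TopologicalSpace MeasureTheory

attribute [summit_statement] _root_.SAWScalingLimit

/-- item stmt-CriticalPhenomena-14003 · target · rank 0 · open · by planner
why it might fail: needs BOTH halves (interior: decoherence + masses; boundary: BoundaryClosureR); F(b_δ)-normalisation universal only for the zigzag class (built in); the collar away from a, b stays free, but relocating the root needs a forced channel, which the rigid ρ-ball excludes; Conj. 2 open since 2010.
sources: DuminilCopinSmirnov2012, arXiv:1007.0575, Smirnov2007ICM, KennedyLawler2013, arXiv:0810.2188, Summit.CriticalPhenomena.SAWScalingLimit.Theorems.SAWDefectDecoherenceHexObservableLimit_refuted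
[target] repaired HexObservableLimit (stmt-CriticalPhenomena-5420, refuted-misstated by
Summit.CriticalPhenomena.SAWScalingLimit.Theorems.SAWDefectDecoherenceHexObservableLimit_refuted —
the corridor witness: with Λ_δ free in the o(1)-collar at ∂Ω a boundary-hugging width-1 corridor
with a moat relocates the conformally effective root (3/4 → 1/2 on the half-disc) while every old
hypothesis holds, so the universal c ≠ 0 forces z(p−q)(1−pq) = 0). DCS 2012 Conjecture 2 (hexagonal
lattice), averaged against bulk test functions ψ ∈ C_c(Ω) and normalised at one boundary mid-edge
b_δ, with the ROOT PINNED CONFORMALLY exactly as b already was: for BOTH marked points p_i (i = 0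
the root a, i = 1 the normalisation point b) the domain is the horizontal half-plane piece {im z >
im p_i} inside the ball B(p_i, ρ) and the discretisation is the exact half-lattice there (v ∈ Λ_δ ↔
row(v) ≥ m_i(δ)); otherwise as before — ∃ c ≠ 0 universal with δ²⟨ψ, F_δ⟩/F_δ(b_δ) → c ∫ ψ
exp((5/8)(L − L_b)) for every such Dobrushin domain, every admissible discretisation family (simply
connected, connected, inside Ω, exhausting compacts), boundary mid-edges a_δ → a, b_δ → b, φ: a ↦ ∞,
b ↦ 0, L = log φ' continuous wi -/
@[route_item "route-CriticalPhenomena-SAWDefectDecoherence", crux]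
def HexObservableLimitR : Prop :=
  ∃ c : ℂ, c ≠ 0 ∧ ∀ (D : Literature.Probability.RandomPlanarGeometry.DobrushinDomain) (ρ : ℝ) (Λ : ℝ → Finset Literature.Probability.LatticeModels.HexVertex) (m : Fin 2 → ℝ → ℤ) (a b : ℝ → Sym2 Literature.Probability.LatticeModels.HexVertex) (Φ : Literature.Probability.RandomPlanarGeometry.ConformalEquiv D.carrier UpperHalfPlane.upperHalfPlaneSet) (L : ℂ → ℂ) (Lb : ℂ) (ψ : ℂ → ℂ), let F : ℝ → Sym2 Literature.Probability.LatticeModels.HexVertex → ℂ := fun δ z => Literature.Probability.RandomPlanarGeometry.SAW.hexParafermionicObservable (Λ δ) (a δ) Literature.Probability.RandomPlanarGeometry.SAW.hexCriticalFugacity (5 / 8) z; 0 < ρ → (∀ i : Fin 2, D.carrier ∩ Metric.ball (D.pt i) ρ = {z : ℂ | (D.pt i).im < z.im} ∩ Metric.ball (D.pt i) ρ) → (∀ᶠ δ : ℝ in nhdsWithin 0 (Set.Ioi 0), Literature.Probability.RandomPlanarGeometry.SAW.hexDomainSimplyConnected (Λ δ) ∧ a δ ∈ Literature.Probability.RandomPlanarGeometry.SAW.hexDomainBoundary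 (Λ δ) ∧ b δ ∈ Literature.Probability.RandomPlanarGeometry.SAW.hexDomainBoundary (Λ δ) ∧ Nonempty (Literature.Probability.RandomPlanarGeometry.SAW.HexMidEdgeSAW (Λ δ) (a δ) (b δ)) ∧ (Literature.Probability.LatticeModels.hexGraph.induce ((Λ δ : Finset Literature.Probability.LatticeModels.HexVertex) : Set Literature.Probability.LatticeModels.HexVertex)).Preconnected ∧ (∀ v ∈ Λ δ, (δ : ℂ) * Literature.Probability.LatticeModels.hexCenter v ∈ D.carrier) ∧ (∀ i : Fin 2, ∀ v : Literature.Probability.LatticeModels.HexVertex, (δ : ℂ) * Literature.Probability.LatticeModels.hexCenter v ∈ Metric.ball (D.pt i) ρ → (v ∈ Λ δ ↔ m i δ ≤ v.1 1))) → (∀ K : Set ℂ, IsCompact K → K ⊆ D.carrier → ∀ᶠ δ : ℝ in nhdsWithin 0 (Set.Ioi 0), ∀ v : Literature.Probability.LatticeModels.HexVertex, (δ : ℂ) * Literature.Probability.LatticeModels.hexCenter v ∈ K → v ∈ Λ δ) → Filter.Tendsto (fun δ : ℝ => (δ : ℂ) * Literature.Probability.RandomPlanarGeometry.SAW.hexMidpoint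 (a δ)) (nhdsWithin 0 (Set.Ioi 0)) (nhds (D.pt 0)) → Filter.Tendsto (fun δ : ℝ => (δ : ℂ) * Literature.Probability.RandomPlanarGeometry.SAW.hexMidpoint (b δ)) (nhdsWithin 0 (Set.Ioi 0)) (nhds (D.pt 1)) → Filter.Tendsto (fun x => ‖Φ x‖) (nhdsWithin (D.pt 0) D.carrier) Filter.atTop → Φ.HasBoundaryValue (D.pt 1) 0 → ContinuousOn L D.carrier → (∀ z ∈ D.carrier, Complex.exp (L z) = deriv Φ z) → Filter.Tendsto L (nhdsWithin (D.pt 1) D.carrier) (nhds Lb) → Continuous ψ → HasCompactSupport ψ → tsupport ψ ⊆ D.carrier → Filter.Tendsto (fun δ : ℝ => (δ : ℂ) ^ 2 * (∑ᶠ e ∈ Literature.Probability.RandomPlanarGeometry.SAW.hexDomainMidEdges (Λ δ), ψ ((δ : ℂ) * Literature.Probability.RandomPlanarGeometry.SAW.hexMidpoint e) * F δ e) / F δ (b δ)) (nhdsWithin 0 (Set.Ioi 0)) (nhds (c * ∫ z, ψ z * Complex.exp ((5 / 8 : ℂ) * (L z - Lb))))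

-- earlier DefectDecoherence (stmt-CriticalPhenomena-8510, replaced 2026-08-15T13:09:29Z -> stmt-CriticalPhenomena-8549): retired by None — ∃ C θ : ℝ, 1 < θ ∧ ∀ (Λ : Finset Literature.Probability.LatticeModels.HexVertex), Literature.Probability.RandomPlanarGeometry.SAW.hexDomainSimplyConnected Λ → ∀ (u w : Literature.Probability.LatticeModels.HexVertex), Literature.Probability.LatticeModels.hexGraph.
/-- item stmt-CriticalPhenomena-8549 · crux · rank 2 · open · by planner
why it might fail: θ > 3/4 against the mass is quantitative: the vertex class imbalance must decay at least like R^{−0.23} relative to the signal R^{−25/48}; persistent lattice-scale class structure (curl not vanishing even weakly), too few screens, or an uncancelled unstable alias n = −1 break it.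
sources: arXiv:1007.0575, arXiv:1009.6077, DuplantierSaleur1988, Jacobsen2009, doi:10.1103/physreve.50.1123, Literature.Barriers.CriticalPhenomena.SAWNoUnitaryCFT
[crux] card K1+K2 as a VERTEX-STAR aggregate (the per-edge version is void: at a fixed edge W ≡ θ_e
− θ_a mod π, so |F_{x,σ−2}(e)| = |F_{x,σ}(e)| by SpinShift — pure aliasing; at the star of a vertex
the six final directions survive and the lifted final-direction law μ_v := Σ_{γ: a → star(v)} x_c^ℓ
δ_{θ_a+W(γ)} is a positive measure on θ₀ + (π/3)ℤ with Fourier period 6). Statement: universal C and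
θ > 3/4 such that for every simply connected hexagonal domain Λ, boundary root a = {u, w} (u ∉ Λ ∋
w), vertex v that is R-deep (every vertex y with |c_y − c_v| ≤ R lies in Λ, R ≥ 1): |Σ_{t ∼ v}
conj(mid{v,t} − c_v) · F_{x_c,5/8}({v,t})| ≤ C R^{−θ} Σ_{t ∼ v} F_{x_c,0}({v,t}). Dictionary: the
un-conjugated combination Σ_t (mid − c_v)F vanishes EXACTLY (DCS Lemma 1 ⟺ μ̂_v(21/8) = 0); the
plain star sum is the signal (μ̂_v(5/8), predicted ≍ R^{−25/48}·mass); the conjugated combination is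
the missing half of Cauchy–Riemann at v and equals (ℓ/2)·μ̂_v(−11/8) up to a unit: the crux says the
lifted final-direction law DECOHERES at frequency 11/8 faster than R^{−3/4} against the mass μ̂_v(0)
= Σ_t Z({v,t}). Predicted exponent θ = 1 + 25/48 (sublattice-gradient term (3ℓ/2)δ∂f of the smooth
limit) wi -/
@[route_item "route-CriticalPhenomena-SAWDefectDecoherence", crux]
def DefectDecoherence : Prop :=
  ∃ C θ : ℝ, 3 / 4 < θ ∧ ∀ (Λ : Finset Literature.Probability.LatticeModels.HexVertex), Literature.Probability.RandomPlanarGeometry.SAW.hexDomainSimplyConnected Λ → ∀ (u w : Literature.Probability.LatticeModels.HexVertex), Literature.Probability.LatticeModels.hexGraph.Adj u w → u ∉ Λ → w ∈ Λ → ∀ (v : Literature.Probability.LatticeModels.HexVertex) (R : ℝ), 1 ≤ R → (∀ y : Literature.Probability.LatticeModels.HexVertex, dist (Literature.Probability.LatticeModels.hexCenter y) (Literature.Probability.LatticeModels.hexCenter v) ≤ R → y ∈ Λ) → ‖∑ t ∈ Λ.filter (fun t => Literature.Probability.LatticeModels.hexGraph.Adj v t), (starRingEnd ℂ) (Literature.Probability.RandomPlanarGeometry.SAW.hexMidpoint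 s(v, t) - Literature.Probability.LatticeModels.hexCenter v) * Literature.Probability.RandomPlanarGeometry.SAW.hexParafermionicObservable Λ s(u, w) Literature.Probability.RandomPlanarGeometry.SAW.hexCriticalFugacity (5 / 8) s(v, t)‖ ≤ C * R ^ (-θ) * ∑ t ∈ Λ.filter (fun t => Literature.Probability.LatticeModels.hexGraph.Adj v t), ‖Literature.Probability.RandomPlanarGeometry.SAW.hexParafermionicObservable Λ s(u, w) Literature.Probability.RandomPlanarGeometry.SAW.hexCriticalFugacity 0 s(v, t)‖

-- earlier MassRatio (stmt-CriticalPhenomena-8511, replaced 2026-08-15T13:10:00Z -> stmt-CriticalPhenomena-8550): retired by None — ∀ (D : Literature.Probability.RandomPlanarGeometry.DobrushinDomain) (ρ : ℝ) (Λ : ℝ → Finset Literature.Probability.LatticeModels.HexVertex) (m : ℝ → ℤ) (a b : ℝ → Sym2 Literature.Probability.LatticeModels.HexVertex), let Z : ℝ → Sym2 Literature.Probability.LatticeModels.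
/-- item stmt-CriticalPhenomena-8550 · crux · rank 3 · open · by planner
why it might fail: needs the boundary two-point function from below and the bulk one from above within δ^{0.23} of the predicted δ^{5/4}, δ^{35/48}; rigorous 2D SAW bounds are far weaker (bridge identities give ≈ δ² per boundary point, unfolding loses e^{c√n}); fjords near a could starve b_δ.
sources: DuminilCopinSmirnov2012, LawlerSchrammWerner2004SAW, MadrasSlade1993, DuminilCopinHammond2013, KennedyLawler2013, arXiv:2310.17299
[crux] positive-measure comparison of critical two-point masses in the target's setting (Dobrushin
domain flat near b, admissible simply connected discretisation family Λ_δ exhausting compacts,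
boundary mid-edges a_δ → a, b_δ → b): for every compact K ⊂ Ω there is C with δ² Σ_{e : δ·mid e ∈ K}
Z_δ(e) ≤ C δ^{−3/4} Z_δ(b_δ) eventually as δ → 0+, where Z_δ = F_{x_c,0} = Σ_{γ : a_δ → ·} x_c^ℓ
(averaged boundary-to-bulk mass against the boundary-to-boundary mass at b_δ; predicted ratio
δ^{−25/48} from h_b = 5/8, x₁ = 5/48; the route's exponent cut is 3/4 — below 1 because every
Taylor/recentring step of the glue costs δ^{1−cut}). [deps: none] [difficulty: open-problem] -/
@[route_item "route-CriticalPhenomena-SAWDefectDecoherence", crux]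
def MassRatio : Prop :=
  ∀ (D : Literature.Probability.RandomPlanarGeometry.DobrushinDomain) (ρ : ℝ) (Λ : ℝ → Finset Literature.Probability.LatticeModels.HexVertex) (m : ℝ → ℤ) (a b : ℝ → Sym2 Literature.Probability.LatticeModels.HexVertex), let Z : ℝ → Sym2 Literature.Probability.LatticeModels.HexVertex → ℂ := fun δ z => Literature.Probability.RandomPlanarGeometry.SAW.hexParafermionicObservable (Λ δ) (a δ) Literature.Probability.RandomPlanarGeometry.SAW.hexCriticalFugacity 0 z; 0 < ρ → D.carrier ∩ Metric.ball (D.pt 1) ρ = {z : ℂ | (D.pt 1).im < z.im} ∩ Metric.ball (D.pt 1) ρ → (∀ᶠ δ : ℝ in nhdsWithin 0 (Set.Ioi 0), Literature.Probability.RandomPlanarGeometry.SAW.hexDomainSimplyConnected (Λ δ) ∧ a δ ∈ Literature.Probability.RandomPlanarGeometry.SAW.hexDomainBoundary (Λ δ) ∧ b δ ∈ Literature.Probability.RandomPlanarGeometry.SAW.hexDomainBoundary (Λ δ) ∧ Nonempty (Literature.Probability.RandomPlanarGeometry.SAW.HexMidEdgeSAW (Λ δ) (a δ) (b δ)) ∧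 (Literature.Probability.LatticeModels.hexGraph.induce ((Λ δ : Finset Literature.Probability.LatticeModels.HexVertex) : Set Literature.Probability.LatticeModels.HexVertex)).Preconnected ∧ (∀ v ∈ Λ δ, (δ : ℂ) * Literature.Probability.LatticeModels.hexCenter v ∈ D.carrier) ∧ (∀ v : Literature.Probability.LatticeModels.HexVertex, (δ : ℂ) * Literature.Probability.LatticeModels.hexCenter v ∈ Metric.ball (D.pt 1) ρ → (v ∈ Λ δ ↔ m δ ≤ v.1 1))) → (∀ K : Set ℂ, IsCompact K → K ⊆ D.carrier → ∀ᶠ δ : ℝ in nhdsWithin 0 (Set.Ioi 0), ∀ v : Literature.Probability.LatticeModels.HexVertex, (δ : ℂ) * Literature.Probability.LatticeModels.hexCenter v ∈ K → v ∈ Λ δ) → Filter.Tendsto (fun δ : ℝ => (δ : ℂ) * Literature.Probability.RandomPlanarGeometry.SAW.hexMidpoint (a δ)) (nhdsWithin 0 (Set.Ioi 0)) (nhds (D.pt 0)) → Filter.Tendsto (fun δ : ℝ => (δ : ℂ) * Literature.Probability.RandomPlanarGeometry.SAW.hexMidpoint (b δ)) (nhdsWithin 0 (Set.Ioi 0)) (nhds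 (D.pt 1)) → ∀ K : Set ℂ, IsCompact K → K ⊆ D.carrier → ∃ C : ℝ, ∀ᶠ δ : ℝ in nhdsWithin 0 (Set.Ioi 0), δ ^ 2 * (∑ᶠ e ∈ {e : Sym2 Literature.Probability.LatticeModels.HexVertex | e ∈ Literature.Probability.RandomPlanarGeometry.SAW.hexDomainMidEdges (Λ δ) ∧ (δ : ℂ) * Literature.Probability.RandomPlanarGeometry.SAW.hexMidpoint e ∈ K}, ‖Z δ e‖) ≤ C * δ ^ (-(3 : ℝ) / 4) * ‖Z δ (b δ)‖

/-- item stmt-CriticalPhenomena-14004 · crux · rank 4 · open · by planner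
why it might fail: weak interior closure gives neither compactness nor a maximum principle; local L¹ bounds on F_δ/F_δ(b_δ) are an exponent-sharp Harnack statement for SAW two-point functions; the boundary modulus carries Kennedy–Lawler lattice factors on the free staircase arcs; c may oscillate with the class at b.
sources: arXiv:1007.0575, arXiv:1009.6077, KennedyLawler2013, arXiv:0810.2188, ChelkakSmirnov2012Ising, DuminilCopinSmirnov2012
[crux] the boundary half, conditional form, over the repaired target: DefectDecoherence → MassRatio
→ HexObservableLimitR (re-targeting of BoundaryClosure, stmt-CriticalPhenomena-8536, whose
conclusion HexObservableLimit was refuted-misstated; same intended proof, checked in Sketch.lean: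
DecoherenceSynthesis (with BoundaryWindingRigidity) turns the two exponent cruxes into
ConjugateClassNegligible for C¹ ψ — asymptotic weak ∂̄-closure of F_δ/F_δ(b_δ) on compacts — and
then the boundary Riemann–Hilbert data — arg F_δ fixed on ∂Ω by winding rigidity, modulus = boundary
two-point function, flat good-zigzag pieces at a AND b — identify the limit: δ²⟨ψ, F_δ⟩/F_δ(b_δ) → c
∫ ψ e^{(5/8)(L − L_b)} with one universal c ≠ 0; the extra rigidity at the root only helps:
reflection across the flat piece controls the uniformising maps up to a). The analogue for this
route of SAWResidueField's HarmonicPartLimit (stmt-5422) without the Hodge split; stated over the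
two earlier cruxes (not over the support node ConjugateClassNegligible) so that the route file
elaborates in rank order. [deps: DefectDecoherence, MassRatio, ConjugateClassNegligible,
DecoherenceSynthesis] [difficulty: open-problem] -/
@[route_item "route-CriticalPhenomena-SAWDefectDecoherence", crux]
def BoundaryClosureR : Prop :=
  DefectDecoherence → MassRatio → HexObservableLimitR

/-- item stmt-CriticalPhenomena-5423 · crux · rank 5 · open · by planner
why it might fail: no RSW/annulus-crossing technology for SAW (n = 0: no FKG; KS17 §4 covers FK, percolation, harmonic explorer, LERW); strongest inputs: sub-ballisticity (DCH13, arXiv:2310.17299); eventual form avoids refuted all-δ item 0772.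
sources: KemppainenSmirnov2017, DuminilCopinHammond2013, arXiv:2310.17299, arXiv:1212.6215, Summit.CriticalPhenomena.SAWScalingLimit.Theorems.SAWParafermionTight_refuted
[crux] eventual tightness of the critical hexagonal SAW laws: for every Dobrushin domain and
hexagonal endpoint approximation (IsEmbEndpointApprox hexGraph hexCenter), the family δ ↦ hexSAWLaw
pushed to CurveClass ℂ is tight along 𝓝[>]0 (IsTightAlongMesh — NOT the refuted all-δ IsTightLaws
form of stmt-CriticalPhenomena-0772). [difficulty: open-problem] -/
@[route_item "route-CriticalPhenomena-SAWDefectDecoherence", crux]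
def HexTight : Prop :=
  ∀ (D : Literature.Probability.RandomPlanarGeometry.DobrushinDomain) (a b : ℝ → Literature.Probability.LatticeModels.HexVertex), Literature.Probability.RandomPlanarGeometry.SAW.IsEmbEndpointApprox Literature.Probability.LatticeModels.hexGraph Literature.Probability.LatticeModels.hexCenter D a b → Literature.Probability.RandomPlanarGeometry.IsTightAlongMesh (fun δ (γ : Literature.Probability.RandomPlanarGeometry.SAW.HexDomainSAW D.carrier δ (a δ) (b δ)) => γ.curve) (fun δ => Literature.Probability.RandomPlanarGeometry.SAW.hexSAWLaw D.carrier δ (a δ) (b δ))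

/-- item stmt-CriticalPhenomena-14005 · crux · rank 6 · open · by planner
why it might fail: the martingale needs the observable limit in the SAW's own slit domains (rough tip a = γ(n), Carathéodory-uniform), while HexObservableLimitR is per fixed Jordan domain, flat and lattice-exact at a and b; projective data fix κ = 8/3 but not the drift, so the b-normalisation is load-bearing.
sources: LawlerSchrammWerner2003, KemppainenSmirnov2017, DuminilCopinSmirnov2012Clay, Smirnov2007ICM, DuminilCopinSmirnov2012, arXiv:math/0209343
[crux] the martingale-observable identification for the hexagonal SAW over the repaired target:
HexObservableLimitR → HexTight → (Duminil-Copin–Smirnov 2012 Conjecture 1 written out: for every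
Dobrushin domain and hexagonal endpoint approximation the critical hexagonal SAW law hexSAWLaw,
pushed to CurveClass ℂ, converges in law to chordal SLE(8/3) — verbatim the definiens of Literature
HexSAWScalingLimit and of the shared item HexConjecture, stmt-CriticalPhenomena-0808); re-targeting
for this route of the shared ObservableToSLE (stmt-CriticalPhenomena-10472), which became vacuous
when its antecedent HexObservableLimit was refuted. Intended proof unchanged: the b-normalised
observable ⟨ψ, F_(Ω∖γ[0,n])⟩/F_(Ω∖γ[0,n])(b) is an exact discrete martingale (domain Markov property
of the SAW), its limit c⟨ψ,(φ_n'/φ_n'(b))^(5/8)⟩ forces the driving process of every subsequential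
limit to be √(8/3)B (LSW03 Prop. 5.2 / Itô on g_t'^(5/8)(g_t − W_t)^(−5/4)), and tightness +
uniqueness of the SLE law conclude (SLEConvergenceCriterion). Now explicit as the FIRST step:
bootstrap Conj. 2 from the flat-pinned family of HexObservableLimitR (a, b on horizontal
half-lattice pieces) to Carathéodory-conve -/
@[route_item "route-CriticalPhenomena-SAWDefectDecoherence", crux]
def ObservableToSLER : Prop :=
  HexObservableLimitR → HexTight → ∀ (D : Literature.Probability.RandomPlanarGeometry.DobrushinDomain) (a b : ℝ → Literature.Probability.LatticeModels.HexVertex), Literature.Probability.RandomPlanarGeometry.SAW.IsEmbEndpointApprox Literature.Probability.LatticeModels.hexGraph Literature.Probability.LatticeModels.hexCenter D a b → Literature.Probability.RandomPlanarGeometry.ConvergesInLawToSLE ((8 : NNReal) / 3) D (fun δ (γ : Literature.Probability.RandomPlanarGeometry.SAW.HexDomainSAW D.carrier δ (a δ) (b δ)) => γ.curve) (fun δ => Literature.Probability.RandomPlanarGeometry.SAW.hexSAWLaw D.carrier δ (a δ) (b δ))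

/-- item stmt-CriticalPhenomena-14221 · crux · rank 7 · open · by planner
why it might fail: open content = lattice universality ℤ² vs Hex of the critical SAW law: uniform ℤ² SAW lies in no Yang–Baxter family (GM19 p.1; barrier NienhuisWeightsExcludeVertexSAW), so no transfer tool exists even given the Hex SLE(8/3) limit; Kennedy–Lawler boundary effects could split ℤ² endpoint classes.
sources: GlazmanManolescu2019, KennedyLawler2013, DuminilCopinSmirnov2012, LawlerSchrammWerner2004SAW, Literature.Barriers.CriticalPhenomena.NienhuisWeightsExcludeVertexSAW, Literature.Barriers.CriticalPhenomena.not_hasExactVertexRelationZ2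
[crux] LATTICE-UNIVERSALITY TRANSFER (conjecture-grade: filed with kind support at rev 7 only
because the at-edit cap check counted 8 with it declared crux; the gate auto-promotes
conjecture-grade items to crux, intended rank 7 — a retriage follows if needed; rev 7 route choice;
replaces in THIS route the shared tail HexConjecture stmt-0808 → HexToSquare stmt-10473 +
LatticeUniversality stmt-0807, which stays with the sibling routes SAWDefectDecoherence /
SAWResidueField / SAWWindingAlias / SAWDevelopingMap): Duminil-Copin–Smirnov 2012 Conjecture 1 —
written out verbatim as the conclusion of ObservableToSLER (for every Dobrushin domain and hexagonal
endpoint approximation IsEmbEndpointApprox the critical hexagonal SAW law hexSAWLaw, pushed to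
CurveClass ℂ, converges in law to chordal SLE(8/3)) — IMPLIES the δℤ² sub-problem statement
SAWScalingLimit. Universality of the critical SAW scaling limit in exactly the implicational form
the assembly needs: weaker than the asymptotic equality of laws LatticeUniversality (it may use
existence and conformal invariance of the hexagonal limit), Iff.rfl-equivalent to HexConjecture →
SAWScalingLimit, implied by HexToSquare ∧ LatticeUniversality ( -/
@[route_item "route-CriticalPhenomena-SAWDefectDecoherence", crux]
def HexTransfer : Prop :=
  (∀ (D : Literature.Probability.RandomPlanarGeometry.DobrushinDomain) (a b : ℝ → Literature.Probability.LatticeModels.HexVertex), Literature.Probability.RandomPlanarGeometry.SAW.IsEmbEndpointApprox Literature.Probability.LatticeModels.hexGraph Literature.Probability.LatticeModels.hexCenter D a b → Literature.Probability.RandomPlanarGeometry.ConvergesInLawToSLE ((8 : NNReal) / 3) D (fun δ (γ : Literature.Probability.RandomPlanarGeometry.SAW.HexDomainSAW D.carrier δ (a δ) (b δ)) => γ.curve) (fun δ => Literature.Probability.RandomPlanarGeometry.SAW.hexSAWLaw D.carrier δ (a δ) (b δ))) → SAWScalingLimit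

/-- item stmt-CriticalPhenomena-8514 · support · rank 9 · closed · proved by Summit.CriticalPhenomena.SAWScalingLimit.Theorems.SpinShift.spinShift_proof (prover) · by planner
sources: DuminilCopinSmirnov2012, arXiv:1203.2959
[support] exact spin-shift identity (finite, every fugacity x and spin σ): for a boundary root a =
{u, w} (u ∉ Λ ∋ w adjacent) and any lattice edge {v, t}: (c_t − c_v)² · F_{x,σ}({v,t}) = (c_w −
c_u)² · F_{x,σ−2}({v,t}) — because e^{iW(γ)} = (last increment)/(first increment) for every polyline
with equal end half-edges (the turning angles telescope), so (final half-edge)² e^{−iσW} = (initial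
half-edge)² e^{−i(σ−2)W} walk by walk; hence ū_e F_σ(e) = −3i (c_w − c_u)² F_{σ−2}(e) with |3(c_w −
c_u)²| = 1. [difficulty: provable-now] -/
@[route_item "route-CriticalPhenomena-SAWDefectDecoherence"]
def SpinShift : Prop :=
  ∀ (Λ : Finset Literature.Probability.LatticeModels.HexVertex) (u w : Literature.Probability.LatticeModels.HexVertex), Literature.Probability.LatticeModels.hexGraph.Adj u w → u ∉ Λ → w ∈ Λ → ∀ (v t : Literature.Probability.LatticeModels.HexVertex), Literature.Probability.LatticeModels.hexGraph.Adj v t → ∀ (x σ : ℝ), (Literature.Probability.LatticeModels.hexCenter t - Literature.Probability.LatticeModels.hexCenter v) ^ 2 * Literature.Probability.RandomPlanarGeometry.SAW.hexParafermionicObservable Λ s(u, w) x σ s(v, t) = (Literature.Probability.LatticeModels.hexCenter w - Literature.Probability.LatticeModels.hexCenter u) ^ 2 * Literature.Probability.RandomPlanarGeometry.SAW.hexParafermionicObservable Λ s(u, w) x (σ - 2) s(v, t)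

/-- item stmt-CriticalPhenomena-8515 · support · rank 9 · closed · proved by Summit.CriticalPhenomena.SAWScalingLimit.Theorems.boundaryWindingRigidity_proof (prover) · by planner
sources: DuminilCopinSmirnov2012, arXiv:1009.6077
[support] for a simply connected hexagonal domain Λ and boundary mid-edges a, b ∈ ∂Ω, all
self-avoiding walks a → b in Ω have the same winding (discrete Umlaufsatz; DCS use it for the
boundary argument of F); consequence used downstream: |F_{x,σ}(b)| = F_{x,0}(b) = Z(b). [difficulty:
L] -/
@[route_item "route-CriticalPhenomena-SAWDefectDecoherence", crux]
def BoundaryWindingRigidity : Prop :=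
  ∀ (Λ : Finset Literature.Probability.LatticeModels.HexVertex), Literature.Probability.RandomPlanarGeometry.SAW.hexDomainSimplyConnected Λ → ∀ a ∈ Literature.Probability.RandomPlanarGeometry.SAW.hexDomainBoundary Λ, ∀ b ∈ Literature.Probability.RandomPlanarGeometry.SAW.hexDomainBoundary Λ, ∀ γ γ' : Literature.Probability.RandomPlanarGeometry.SAW.HexMidEdgeSAW Λ a b, γ.winding = γ'.winding

/-- item stmt-CriticalPhenomena-8516 · support · rank 9 · closed · proved by Summit.CriticalPhenomena.SAWScalingLimit.Theorems.StaggeredSumRule_proof (prover) · by planner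
sources: DuminilCopinSmirnov2012, arXiv:1007.0575, Literature.Barriers.CriticalPhenomena.ParafermionicHalfCauchyRiemann
[support] the exact counter-term (card P1): from DCS Lemma 1
(`DuminilCopinSmirnov2012_lemma1_holds`), for Λ simply connected, a ∈ ∂Ω and every vertex set B ⊆ Λ:
2·Σ_{black v ∈ B} Σ_{w ∈ B, w ∼ v} (mid{v,w} − c_v) F({v,w}) + Σ_{v ∈ B} ε(v) Σ_{w ∼ v, w ∉ B}
(mid{v,w} − c_v) F({v,w}) = 0, ε = +1 on black (v.2 = 0), −1 on white (sum of ε(v)·(vertex relation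
at v); interior edges double, edges leaving B appear once); corollary |Σ_{e ⊆ B} u_e F(e)| ≤
(1/(4√3)) Σ_{e leaving B} |F(e)| — the u-twisted (spin σ+2 / staggered σ−1) component is a pure
boundary term, O(δ²) against smooth test functions. [difficulty: provable-now] -/
@[route_item "route-CriticalPhenomena-SAWDefectDecoherence"]
def StaggeredSumRule : Prop :=
  ∀ (Λ : Finset Literature.Probability.LatticeModels.HexVertex), Literature.Probability.RandomPlanarGeometry.SAW.hexDomainSimplyConnected Λ → ∀ a ∈ Literature.Probability.RandomPlanarGeometry.SAW.hexDomainBoundary Λ, ∀ B : Finset Literature.Probability.LatticeModels.HexVertex, B ⊆ Λ → let F : Sym2 Literature.Probability.LatticeModels.HexVertex → ℂ := Literature.Probability.RandomPlanarGeometry.SAW.hexParafermionicObservable Λ a Literature.Probability.RandomPlanarGeometry.SAW.hexCriticalFugacity (5 / 8); 2 * (∑ v ∈ B.filter (fun v => v.2 = 0), ∑ w ∈ B.filter (fun w => Literature.Probability.LatticeModels.hexGraph.Adj v w), (Literature.Probability.RandomPlanarGeometry.SAW.hexMidpoint s(v, w) - Literature.Probability.LatticeModels.hexCenter v) * F s(v,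 w)) + ∑ v ∈ B, (if v.2 = 0 then (1 : ℂ) else -1) * ∑ᶠ w ∈ {w : Literature.Probability.LatticeModels.HexVertex | Literature.Probability.LatticeModels.hexGraph.Adj v w ∧ w ∉ B}, (Literature.Probability.RandomPlanarGeometry.SAW.hexMidpoint s(v, w) - Literature.Probability.LatticeModels.hexCenter v) * F s(v, w) = 0

-- earlier ConjugateClassNegligible (stmt-CriticalPhenomena-8513, replaced 2026-08-15T13:10:22Z -> stmt-CriticalPhenomena-8551): retired by None — ∀ (D : Literature.Probability.RandomPlanarGeometry.DobrushinDomain) (ρ : ℝ) (Λ : ℝ → Finset Literature.Probability.LatticeModels.HexVertex) (m : ℝ → ℤ) (a b : ℝ → Sym2 Literature.Probability.LatticeModels.HexVertex) (ψ : ℂ → ℂ), let F : ℝ → Sym2 Literature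
/-- item stmt-CriticalPhenomena-8551 · support · rank 9 · open · by planner
sources: arXiv:1007.0575, arXiv:1009.6077, Summits/CriticalPhenomena/SAWScalingLimit/Ideas/parafermion-defect-stability-skeleton.md
[support] the NODE the engine delivers (card "CE" = route SAWResidueField's foreseen
CurlIsMesoscopicallySmall, L¹/weak form): in the target's setting, for every ψ ∈ C¹_c(Ω) (C¹ so that
the vertex-star Taylor step costs δ^{1−3/4}), δ² Σ_{black b ∼ white w, {b,w} a domain mid-edge}
ψ(δ·mid) · conj(c_w − c_b) · F_δ({b,w}) / F_δ(b_δ) → 0 as δ → 0+ — the conjugate-class (ū-twisted)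
average of the σ = 5/8 observable is negligible against its boundary value. With the vertex relation
(summation by parts: Σ_e F_δ(e)[∂̄φ + u_e²∂φ](δe) = O(δ²)·mass and u² = i·ū) this is asymptotic weak
∂̄-closure of F_δ/F_δ(b_δ) on compacts. Derived by DecoherenceSynthesis from DefectDecoherence +
MassRatio + BoundaryWindingRigidity; standalone it is open (and any other engine, e.g.
SAWResidueField's energy route, may prove it directly). -/
@[route_item "route-CriticalPhenomena-SAWDefectDecoherence"]
def ConjugateClassNegligible : Prop :=
  ∀ (D : Literature.Probability.RandomPlanarGeometry.DobrushinDomain) (ρ : ℝ) (Λ : ℝ → Finset Literature.Probability.LatticeModels.HexVertex) (m : ℝ → ℤ) (a b : ℝ → Sym2 Literature.Probability.LatticeModels.HexVertex) (ψ : ℂ → ℂ), let F : ℝ → Sym2 Literature.Probability.LatticeModels.HexVertex → ℂ := fun δ z => Literature.Probability.RandomPlanarGeometry.SAW.hexParafermionicObservable (Λ δ) (a δ) Literature.Probability.RandomPlanarGeometry.SAW.hexCriticalFugacity (5 / 8) z; 0 < ρ → D.carrier ∩ Metric.ball (D.pt 1) ρ = {z : ℂ | (D.pt 1).im < z.im}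 ∩ Metric.ball (D.pt 1) ρ → (∀ᶠ δ : ℝ in nhdsWithin 0 (Set.Ioi 0), Literature.Probability.RandomPlanarGeometry.SAW.hexDomainSimplyConnected (Λ δ) ∧ a δ ∈ Literature.Probability.RandomPlanarGeometry.SAW.hexDomainBoundary (Λ δ) ∧ b δ ∈ Literature.Probability.RandomPlanarGeometry.SAW.hexDomainBoundary (Λ δ) ∧ Nonempty (Literature.Probability.RandomPlanarGeometry.SAW.HexMidEdgeSAW (Λ δ) (a δ) (b δ)) ∧ (Literature.Probability.LatticeModels.hexGraph.induce ((Λ δ : Finset Literature.Probability.LatticeModels.HexVertex) : Set Literature.Probability.LatticeModels.HexVertex)).Preconnected ∧ (∀ v ∈ Λ δ, (δ : ℂ) * Literature.Probability.LatticeModels.hexCenter v ∈ D.carrier) ∧ (∀ v : Literature.Probability.LatticeModels.HexVertex, (δ : ℂ) * Literature.Probability.LatticeModels.hexCenter v ∈ Metric.ball (D.pt 1) ρ → (v ∈ Λ δ ↔ m δ ≤ v.1 1))) → (∀ K : Set ℂ, IsCompact K → K ⊆ D.carrier → ∀ᶠ δ : ℝ in nhdsWithin 0 (Set.Ioi 0),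 ∀ v : Literature.Probability.LatticeModels.HexVertex, (δ : ℂ) * Literature.Probability.LatticeModels.hexCenter v ∈ K → v ∈ Λ δ) → Filter.Tendsto (fun δ : ℝ => (δ : ℂ) * Literature.Probability.RandomPlanarGeometry.SAW.hexMidpoint (a δ)) (nhdsWithin 0 (Set.Ioi 0)) (nhds (D.pt 0)) → Filter.Tendsto (fun δ : ℝ => (δ : ℂ) * Literature.Probability.RandomPlanarGeometry.SAW.hexMidpoint (b δ)) (nhdsWithin 0 (Set.Ioi 0)) (nhds (D.pt 1)) → ContDiff ℝ 1 ψ → HasCompactSupport ψ → tsupport ψ ⊆ D.carrier → Filter.Tendsto (fun δ : ℝ => (δ : ℂ) ^ 2 * (∑ᶠ p ∈ {p : Literature.Probability.LatticeModels.HexVertex × Literature.Probability.LatticeModels.HexVertex | s(p.1, p.2) ∈ Literature.Probability.RandomPlanarGeometry.SAW.hexDomainMidEdges (Λ δ) ∧ p.1.2 = 0}, ψ ((δ : ℂ) * Literature.Probability.RandomPlanarGeometry.SAW.hexMidpoint s(p.1, p.2)) * (starRingEnd ℂ) (Literature.Probability.LatticeModels.hexCenter p.2 - Literature.Probability.LatticeModels.hexCenter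 p.1) * F δ s(p.1, p.2)) / F δ (b δ)) (nhdsWithin 0 (Set.Ioi 0)) (nhds 0)

-- earlier DecoherenceSynthesis (stmt-CriticalPhenomena-8517, replaced 2026-08-15T13:11:12Z -> stmt-CriticalPhenomena-8558): retired by None — SpinShift → BoundaryWindingRigidity → DefectDecoherence → MassRatio → ConjugateClassNegligible
/-- item stmt-CriticalPhenomena-8558 · support · rank 9 · closed · proved by Summit.CriticalPhenomena.SAWScalingLimit.Theorems.DecoherenceSynthesis_proof (prover) · by planner
sources: DuminilCopinSmirnov2012, Summits/CriticalPhenomena/SAWScalingLimit/Ideas/parafermion-defect-stability-skeleton.md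
[support] glue of layer 1: BoundaryWindingRigidity → DefectDecoherence → MassRatio →
ConjugateClassNegligible (SpinShift, the aliasing witness, is no longer a hypothesis: the
vertex-star form of DefectDecoherence is used directly). For ψ ∈ C¹ supported in a compact K ⊂ Ω at
distance 2d from ∂Ω, exhaustion puts the lattice ball of radius d/δ about every vertex with δ·c_v
near K inside Λ_δ eventually; group the black→white edge sum by black vertex b: Σ_e ψ(δ·mid e)
conj(c_w − c_b) F = Σ_b ψ(δc_b)·T(b) + Σ_b Σ_{w∼b} [ψ(δ·mid) − ψ(δc_b)] conj(c_w − c_b) F, with T(b)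
= 2Σ_{w∼b} conj(mid − c_b) F({b,w}) the vertex-star defect; DefectDecoherence bounds |T(b)| by C
(d/δ)^{−θ} Σ_{w∼b} Z({b,w}), the Taylor term is ≤ δ‖∇ψ‖_∞ (1/√3) Σ_K Z; MassRatio bounds δ²Σ_K Z_δ
by C δ^{−3/4} Z_δ(b_δ) and BoundaryWindingRigidity gives Z_δ(b_δ) = |F_δ(b_δ)|; total ≤ C'(δ^{θ−3/4}
+ δ^{1/4}) → 0. [difficulty: M] -/
@[route_item "route-CriticalPhenomena-SAWDefectDecoherence"]
def DecoherenceSynthesis : Prop :=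
  BoundaryWindingRigidity → DefectDecoherence → MassRatio → ConjugateClassNegligible

-- earlier Assembly (stmt-CriticalPhenomena-14006, replaced 2026-08-16T00:08:31Z -> stmt-CriticalPhenomena-14046): retired by None — DefectDecoherence → MassRatio → BoundaryClosureR → HexTight → ObservableToSLER → HexToSquare → LatticeUniversality → SAWScalingLimit
-- earlier Assembly (stmt-CriticalPhenomena-14046, replaced 2026-08-16T06:36:13Z -> stmt-CriticalPhenomena-14861): retired by None — DefectDecoherence → MassRatio → BoundaryClosureR → HexTight → ObservableToSLER → LatticeUniversality → SAWScalingLimit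
-- earlier Assembly (stmt-CriticalPhenomena-8518, replaced 2026-08-15T12:59:04Z -> stmt-CriticalPhenomena-8539): retired by None — SpinShift → BoundaryWindingRigidity → DecoherenceSynthesis → DefectDecoherence → MassRatio → BoundaryClosure → HexTight → ObservableToSLE → HexToSquare → LatticeUniversality → SAWScalingLimit
-- earlier Assembly (stmt-CriticalPhenomena-8539, replaced 2026-08-16T00:00:02Z -> stmt-CriticalPhenomena-14006): retired by None — DefectDecoherence → MassRatio → BoundaryClosure → HexTight → ObservableToSLE → HexToSquare → LatticeUniversality → SAWScalingLimit
/-- item stmt-CriticalPhenomena-14861 · assembly · rank 1 · open · by planner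
sources: DuminilCopinSmirnov2012, KemppainenSmirnov2017, GlazmanManolescu2019
[assembly] the non-glue FRAME statement (rev 20; restated because its rev-16 form,
stmt-CriticalPhenomena-14046, named the crux LatticeUniversality — restated into HexTransfer at rev
20 — and carried the hex → δℤ² transport as a HYPOTHESIS of `closes`, which the crux-only rule
forbids): the line's two estimates, tightness and the tail suffice — DefectDecoherence → MassRatio →
HexTight → HexTransfer → SAWScalingLimit. Proved exactly by the route's two implication cruxes once
they land: `fun hDD hMR hT hTr => hTr (hO (hBC hDD hMR) hT)` with hBC : BoundaryClosureR, hO :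
ObservableToSLER (term checked in the seat's Sketch.lean, rc 0); no ground battery closes or refutes
it (it needs BoundaryClosureR and ObservableToSLER: intros; aesop / simp_all / tauto / trivial /
exact? all fail, SketchProbe.lean). It adds no assumption beyond the cruxes and is NOT a hypothesis
of `closes`, which binds the six non-target cruxes directly. [deps: BoundaryClosureR,
ObservableToSLER, HexTransfer] [difficulty: M — exactly the two implication cruxes] -/
@[route_item "route-CriticalPhenomena-SAWDefectDecoherence"]
def Assembly : Prop :=
  DefectDecoherence → MassRatio → HexTight → HexTransfer → SAWScalingLimit

-- records of items no longer active in this route (dropped / restated):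
-- earlier LatticeUniversality (stmt-CriticalPhenomena-0807, replaced 2026-08-16T06:36:13Z -> stmt-CriticalPhenomena-14221): open — ∀ (D : Literature.Probability.RandomPlanarGeometry.DobrushinDomain) (a b : ℝ → Literature.Probability.LatticeModels.Site 2) (a' b' : ℝ → Literature.Probability.LatticeModels.HexVertex), Literature.Probability.RandomPlanarGeometry.SAW.IsEndpointApprox D a b → Literature.P
-- earlier ObservableToSLE (stmt-CriticalPhenomena-10472, replaced 2026-08-16T00:00:02Z -> stmt-CriticalPhenomena-14005): open — HexObservableLimit → HexTight → ∀ (D : Literature.Probability.RandomPlanarGeometry.DobrushinDomain) (a b : ℝ → Literature.Probability.LatticeModels.HexVertex), Literature.Probability.RandomPlanarGeometry.SAW.IsEmbEndpointApprox Literature.Probability.LatticeModels.hexGraph 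
-- earlier HexObservableLimit (stmt-CriticalPhenomena-5420, replaced 2026-08-16T00:00:02Z -> stmt-CriticalPhenomena-14003): refuted by Summit.CriticalPhenomena.SAWScalingLimit.Theorems.SAWDefectDecoherenceHexObservableLimit_refuted @ b90fe791a4c9 — ∃ c : ℂ, c ≠ 0 ∧ ∀ (D : Literature.Probability.RandomPlanarGeometry.DobrushinDomain) (ρ : ℝ) (Λ : ℝ → Finset Literature.Probability.LatticeModels.HexVerte
-- earlier ObservableToSLE (stmt-CriticalPhenomena-5424, replaced 2026-08-15T16:21:47Z -> stmt-CriticalPhenomena-10472): retired by None — HexObservableLimit → HexTight → Literature.Probability.RandomPlanarGeometry.SAW.HexSAWScalingLimit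
-- earlier HexToSquare (stmt-CriticalPhenomena-5428, replaced 2026-08-15T16:21:47Z -> stmt-CriticalPhenomena-10473): retired by None — Literature.Probability.RandomPlanarGeometry.SAW.HexSAWScalingLimit → LatticeUniversality → SAWScalingLimit
-- earlier BoundaryClosure (stmt-CriticalPhenomena-8512, replaced 2026-08-15T12:58:31Z -> stmt-CriticalPhenomena-8536): retired by None — MassRatio → ConjugateClassNegligible → HexObservableLimit
-- earlier BoundaryClosure (stmt-CriticalPhenomena-8536, replaced 2026-08-16T00:00:02Z -> stmt-CriticalPhenomena-14004): retired by None — DefectDecoherence → MassRatio → HexObservableLimit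

/-! D-0027 §2.1 — DECIDING THEOREM (planner-authored via `route open/edit --closes-file`; by planner-rchoice-CriticalPhenomena-SAWDefectDec-f28a3bf5-0 2026-08-16T06:36:13Z):
its hypotheses are this route's items and its conclusion the sub-problem Statement (glue_lint), and it elaborates with this file. -/

@[closes "route-CriticalPhenomena-SAWDefectDecoherence"] theorem closes (hDD : DefectDecoherence) (hMR : MassRatio) (hBC : BoundaryClosureR)
    (hT : HexTight) (hO : ObservableToSLER) (hTr : HexTransfer) : _root_.SAWScalingLimit :=
  -- layer 1: BoundaryClosureR turns the two exponent cruxes into the thesis X = HexObservableLimitR;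
  -- layer 2 (shared pipeline): ObservableToSLER turns X + HexTight into DCS Conjecture 1 on the
  -- hexagonal lattice (written out) and HexTransfer carries it to δℤ². Crux-only: every binder is a crux item.
  hTr (hO (hBC hDD hMR) hT)

end Summit.CriticalPhenomena.SAWScalingLimit.Theses.SAWDefectDecoherence
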